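import Summits.BirchSwinnertonDyer.Rank1Residual.GaloisImage.KolyvaginLevelOneUnitCaseNoS24
import Summits.BirchSwinnertonDyer.Rank1Residual.GaloisImage.KolyvaginLevelOneUnitCaseOfFacts
import HarnessLib

/-!
# The EXOTIC unit case from the level-one dictionary (DICT3₁), named facts `hPT`, `hEP` ONLY —
# n1011-p13's `KolyvaginLevelOneUnitCaseOfKatoClasses` / `…OfFacts` END theorems WITHOUT the two
# [S24] named facts (cell `b2b-bsdres`, team n1011, ROUTE-1 item R1-56 sub-item K6; row T-R1-56-K6,
# seat p09 GEN 6; file 5 of the row; skeleton `cells/n1011/skel/T-R1-56-K6.md`)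

HONEST FRAMING (cell `b2b-bsdres`, run/shared/lean/b2b/bsd-rank1-residual/, verbatim in every
file): the goal of the cell is to DELETE the COMBINATION-SHAPED residual classes of the
Birch–Swinnerton-Dyer formula for ALL analytic-rank `≤ 1` elliptic curves over `ℚ` — "full BSD
formula for every rank `≤ 1` curve in class `C`" assembled STRICTLY from published theorems — so
that the rank-`≤ 1` remainder becomes exactly the CONSTRUCTION-SHAPED classes, which are TYPED
(missing-input `Prop`s), NOT attempted. This is not "finishing BSD". Team n1011 (N10/N11, the
additive block `X4 ∧ p = 3`): research route; no claim beyond the stated classes; the label X4 and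
the mark of RESIDUAL-MAP §I N11 are UNCHANGED by this file; nothing is booked. Theorems only: no
definition, no named fact is minted. The END theorems here are CONDITIONAL on the named facts
`poitouTate_selmerStructure_duality ℚ` (`hPT`) and Tate's `localEulerPoincareCharacteristic` (`hEP`),
and on THE PORT `KatoKuriharaDictionaryThreeOneAt W 0 D v₃` (DICT3₁, a hypothesis — the typed
located gap of row T-a5x / route R1-21, UNCHANGED) — and on NOTHING from [S24].

## What

n1011-p13's T-a5x-II END theorems (p275780 `KolyvaginLevelOneUnitCaseOfFacts`): on an additive
`3 ∤ c₃`, surj(3), `E(ℚ₃)[3] = 0`, `r_an = 0`, `3 ∤ #Ш_an` row, DICT3₁ + `hS24` + `hS24₂` + `hPT` +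
`hEP` ⟹ `BSD(E, 3)`, by the chain DICT3₁ → Kato classes → level-one certificate
(`apply_empty_not_mem_selmerGroup_kummer_of_dictionary`) → `#Sel^{(3)} = 1`
(`natCard_selmerGroup_three_eq_one_of_levelOne_certificate`, the ONLY consumer of `hS24`, `hS24₂`) →
the GZK-free certificate consumer `bsdp_of_card_selmerGroup_eq_one_of_analyticRank_eq_zero`.  File 4
of this row (`KolyvaginLevelOneUnitCaseNoS24`) re-proved the `#Sel^{(3)} = 1` step from Mazur–Rubin
Thm. 4.3.4 / Rubin PCMI Thm. 2.8.4 at `m = 1` (file 1, p284602), a THEOREM.  Here the END theorems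
are re-run VERBATIM on top of it:

* `bsdp_three_of_katoClasses_levelOne_noS24` (= p13's `bsdp_three_of_katoClasses_levelOne`,
  `KolyvaginLevelOneUnitCaseOfKatoClasses`, MINUS `hS24`, `hS24₂`, `hunro`);
* `bsdp_three_of_dictionaryOne_of_facts_noS24` (= p13's `bsdp_three_of_dictionaryOne_of_facts` MINUS
  `hS24`, `hS24₂`): **DICT3₁ + `hPT` + `hEP` + row conditions ⟹ `BSD(E, 3)`**;
* `exists_kolyvaginDatum_bsdp_three_of_dictionaryOne_of_facts_noS24`,
  `exists_kolyvaginDatum_bsdp_three_of_dictionaryAt_zero_of_facts_noS24` (the `∃ S τ η D v₃` forms,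
  the second in n1011-p09 GEN 3's level spelling `KatoKuriharaDictionaryThreeAt W 0 0 D v₃`).

So the EXOTIC unit-case END of record now reads: NAMED FACTS `hPT`, `hEP` + A-PRIORI ROW CONDITIONS +
THE PORT DICT3₁ ⟹ `BSD(E, 3)` — the two [S24] named facts are GONE.  EXOTIC rows stay REDUCED (to
DICT3₁ + `hPT` + `hEP`), none closed; nothing booked; no mark / label changed.

References: [Rubin2011] Thm. 2.8.4 (p. 25); [MazurRubin2004] Thm. 4.3.4 (p. 45); [Kim2022StructureSelmer]
Thm. 3.13; [MilneADT2006] I Thm. 4.10 (b); [Miller2011LMS] §1, Def. 1.1.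
-/

noncomputable section

open scoped Classical NumberField ContRepresentation
open Field NumberField IsDedekindDomain
open WeierstrassCurve Literature.NumberTheory.EllipticCurves Literature.NumberTheory.EllipticCurves.ModularForms
  Literature.NumberTheory.EllipticCurves.Rank1Residual
  Literature.NumberTheory.EllipticCurves.Rank1Residual.Typed
  Literature.NumberTheory.GaloisRepresentations
  Literature.NumberTheory.GaloisRepresentations.DiscreteGaloisModule Literature.NumberTheory.GaloisCohomology
open Literature.NumberTheory.DiophantineGeometry.Dioph (ratModP)

namespace Summit.BirchSwinnertonDyer.Rank1Residual.GaloisImage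

variable (W : WeierstrassCurve ℚ) [W.IsElliptic]

/-- **BSD(E, 3) from Kato-type classes at level one, WITHOUT the [S24] facts** — n1011-p13's
`bsdp_three_of_katoClasses_levelOne` (`KolyvaginLevelOneUnitCaseOfKatoClasses`) with `hS24`, `hS24₂`,
`hunro` DELETED: the Kato-type classes (a family `κ₀`, a Kolyvagin system `κ'` congruent to it (I4),
a functional `Λ` with the Kummer kernel clause and the value clause `Λ(loc_{v₃} κ₀ ∅) = u·3^t·δ̃`,
`t = 0`, `δ̃ ≠ 0`) give the level-one certificate (p13's
`apply_empty_not_mem_selmerGroup_kummer_of_dictionary`), and file 4's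
`bsdp_three_of_levelOne_certificate_noS24` concludes.  Binders otherwise VERBATIM p13's; the Kato-type
clauses are BINDERS ([K22] Thm. 3.13 at `m = 1`, additive `3` — route R1-21).  NO tower, NO (im),
NO reduction type; nothing booked. [cite: Kim2022StructureSelmer, Thm. 3.13]
[cite: Rubin2011, Thm. 2.8.4 (p. 25)] [cite: Miller2011LMS, §1 and Def. 1.1] -/
theorem bsdp_three_of_katoClasses_levelOne_noS24
    (hGZK : rank_eq_analyticRank_of_analyticRank_le_one)
    [Finite (geomTorsion W ((3 : ℕ) : ℤ))]
    (h3 : W.HasSurjectiveModNGaloisRep ((3 : ℕ) : ℤ)) (hr : W.analyticRank = 0)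
    {q : ℚ} (hq : shaAn W = (q : ℂ)) (hv : padicValRat 3 q = 0)
    (τ : absoluteGaloisGroup ℚ) (hτμ : τ ∈ rootsOfUnityFixer ℚ 3)
    (hτq : Nonempty (cokerSubOne (W.torsionGaloisModule ((3 : ℕ) : ℤ)) τ ≃+ ZMod 3))
    (inv : LocalInvariants ℚ 3) (hperf : inv.IsPerfect) (hsum : inv.SumLocalTermEqZero)
    (hcompl : inv.SelmerComplement)
    (hEP : ∀ v : HeightOneSpectrum (𝓞 ℚ), localEulerPoincareCharacteristic (v.adicCompletion ℚ))
    (S : Finset (Place ℚ)) (hS : ∀ w : InfinitePlace ℚ, (Sum.inl w : Place ℚ) ∈ S)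
    (h3S : ∀ v : HeightOneSpectrum (𝓞 ℚ), ((3 : ℕ) : 𝓞 ℚ) ∈ v.asIdeal → (Sum.inr v : Place ℚ) ∈ S)
    (hbadS : ∀ v : HeightOneSpectrum (𝓞 ℚ), ¬ W.HasGoodReductionAt v → (Sum.inr v : Place ℚ) ∈ S)
    (D : KolyvaginDatum (W.torsionGaloisModule ((3 : ℕ) : ℤ)))
    (η : (q : HeightOneSpectrum (𝓞 ℚ)) → (ZMod (Ideal.absNorm q.asIdeal))ˣ)
    (hP : D.primes = frobeniusClassPrimes (W.torsionGaloisModule ((3 : ℕ) : ℤ))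
      {v | (Sum.inr v : Place ℚ) ∈ S} τ 3)
    (hT : D.transverse = cyclotomicTransverse (W.torsionGaloisModule ((3 : ℕ) : ℤ)))
    (hD : D.HasCanonicalComparison 3 η)
    -- the Kato-type classes at level one (route R1-21's dictionary at `m = 1`, on `E[3]`)
    (v₃ : HeightOneSpectrum (𝓞 ℚ))
    (κ₀ : Finset (HeightOneSpectrum (𝓞 ℚ)) → galoisCohomology (W.torsionGaloisModule ((3 : ℕ) : ℤ)) 1)
    (κ' : D.kolyvaginSystems (propagatedSelmerStructureOne W 3))
    (hI4 : ∀ d, D.IsLevel d →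
      κ'.1 d - κ₀ d ∈ AddSubgroup.closure {x | ∃ c, c ⊂ d ∧ x = κ₀ c})
    (Λ : galoisCohomology ((W.torsionGaloisModule ((3 : ℕ) : ℤ)).toLocal (Sum.inr v₃)) 1 →+ ZMod 3)
    (hΛker : ∀ x ∈ propagatedSelmerStructureOne W 3 (Sum.inr v₃),
      Λ x = 0 ↔ x ∈ W.kummerSelmerStructure ((3 : ℕ) : ℤ) (Sum.inr v₃))
    {u : (ZMod 3)ˣ} {t : ℕ} {δ : ZMod 3}
    (hval : Λ (galoisCohomology.localization _ (Sum.inr v₃) 1 (κ₀ ∅)) =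
      (u : ZMod 3) * (3 : ZMod 3) ^ t * δ)
    (ht : t = 0) (hδ : δ ≠ 0) :
    BSDp W 3 :=
  bsdp_three_of_levelOne_certificate_noS24 W hGZK h3 hr hq hv τ hτμ hτq inv hperf hsum hcompl hEP S hS
    h3S hbadS D η hP hT hD κ'
    (apply_empty_not_mem_selmerGroup_kummer_of_dictionary W v₃ κ₀ κ' hI4 Λ hΛker hval ht hδ)

/-- **The EXOTIC unit case from DICT3 at level one — NAMED FACTS `hPT`, `hEP` ONLY, NO GZK, NO [S24].**
n1011-p13's `bsdp_three_of_dictionaryOne_of_facts` (p275780) with `hS24`, `hS24₂` DELETED.  For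
`W/ℚ` globally minimal, additive at `3` with `3 ∤ c₃`, `ρ̄_{E,3}` onto, `E(ℚ₃)[3] = 0`, `r_an = 0`,
`3 ∤ #Ш_an`, a `τ`-datum at level `3`, Tate's `hEP`, an admissible `S`, a Kolyvagin datum `D` on
`E[3]` for `𝒫(τ)` with cyclotomic transverse conditions and canonical comparison maps, `v₃ ∣ 3`,
THE PORT `KatoKuriharaDictionaryThreeOneAt W 0 D v₃`, and a modular parametrisation `P` with
`3 ∤ c_P`, the `3`-adic unit period transfer and `[0]⁺` a `3`-adic unit: `BSD(E, 3)`.  Chain: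
DICT3₁ → Kato classes → certificate (p13's `apply_empty_not_mem_selmerGroup_kummer_of_dictionary`) →
`#Sel^{(3)} = 1` (file 4's `natCard_selmerGroup_three_eq_one_of_levelOne_certificate_noS24` =
Mazur–Rubin Thm. 4.3.4 at `m = 1` + core rank one, NO Kolyvagin-system structure theorem) → p13's
GZK-free consumer `bsdp_of_card_selmerGroup_eq_one_of_analyticRank_eq_zero`.  NO tower, NO (im), NO
GZK, NO [S24].  EXOTIC rows REDUCED (to DICT3₁ + `hPT`, `hEP`), none closed; nothing booked; no mark /
label changed. [cite: Kim2022StructureSelmer, Thm. 3.13] [cite: Rubin2011, Thm. 2.8.4 (p. 25)]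
[cite: MilneADT2006, Ch. I, Thm. 4.10(b)] [cite: Miller2011LMS, §1 and Def. 1.1] -/
theorem bsdp_three_of_dictionaryOne_of_facts_noS24 [W.IsGloballyMinimal]
    (hPT : poitouTate_selmerStructure_duality ℚ)
    (hEP : ∀ v : HeightOneSpectrum (𝓞 ℚ), localEulerPoincareCharacteristic (v.adicCompletion ℚ))
    [Finite (geomTorsion W ((3 : ℕ) : ℤ))]
    (hX : Addv W 3) (hc3 : ¬ 3 ∣ (W.baseChange ℚ_[3]).localTamagawaNumber ℤ_[3])
    (h3 : W.HasSurjectiveModNGaloisRep ((3 : ℕ) : ℤ)) (hr : W.analyticRank = 0)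
    (ht : Nat.card {Q : (W.baseChange ℚ_[3]).toAffine.Point // (3 : ℕ) • Q = 0} = 1)
    {q : ℚ} (hq : shaAn W = (q : ℂ)) (hv : padicValRat 3 q = 0)
    (τ : absoluteGaloisGroup ℚ) (hτμ : τ ∈ rootsOfUnityFixer ℚ 3)
    (hτq : Nonempty (cokerSubOne (W.torsionGaloisModule ((3 : ℕ) : ℤ)) τ ≃+ ZMod 3))
    (S : Finset (Place ℚ)) (hS : ∀ w : InfinitePlace ℚ, (Sum.inl w : Place ℚ) ∈ S)
    (h3S : ∀ v : HeightOneSpectrum (𝓞 ℚ), ((3 : ℕ) : 𝓞 ℚ) ∈ v.asIdeal → (Sum.inr v : Place ℚ) ∈ S)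
    (hbadS : ∀ v : HeightOneSpectrum (𝓞 ℚ), ¬ W.HasGoodReductionAt v → (Sum.inr v : Place ℚ) ∈ S)
    (D : KolyvaginDatum (W.torsionGaloisModule ((3 : ℕ) : ℤ)))
    (η : (q : HeightOneSpectrum (𝓞 ℚ)) → (ZMod (Ideal.absNorm q.asIdeal))ˣ)
    (hP : D.primes = frobeniusClassPrimes (W.torsionGaloisModule ((3 : ℕ) : ℤ))
      {v | (Sum.inr v : Place ℚ) ∈ S} τ 3)
    (hT : D.transverse = cyclotomicTransverse (W.torsionGaloisModule ((3 : ℕ) : ℤ)))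
    (hD : D.HasCanonicalComparison 3 η)
    (v₃ : HeightOneSpectrum (𝓞 ℚ)) (hv₃ : ((3 : ℕ) : 𝓞 ℚ) ∈ v₃.asIdeal)
    (hDict : KatoKuriharaDictionaryThreeOneAt W 0 D v₃)
    {N : ℕ} [NeZero N] (P : ModularParametrizationData W N)
    (hManin : ¬ ((3 : ℕ) : ℤ) ∣ P.maninConstant)
    (hΩ : ∃ u : ℚ, ‖(u : ℚ_[3])‖ = 1 ∧ W.realPeriodRat = u * plusPeriod P.f)
    (hunit : ratModP 3 (ratPlusSymbol P.f 0) ≠ 0) :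
    BSDp W 3 := by
  haveI : Fact (Nat.Prime 3) := ⟨Nat.prime_three⟩
  -- the Poitou–Tate family from the named fact
  obtain ⟨inv, hperf, hsum, -, hcompl⟩ := hPT 3
  -- the dictionary at `∅`: Kato-type classes with a unit value
  obtain ⟨κ₀, Λ, -, ⟨κ', hI4⟩, -, hΛker, hdict⟩ :=
    hDict hX hc3 h3 (by rw [ht, pow_zero]) hv₃ P hManin hΩ
  obtain ⟨u, ψ, -, hval⟩ := hdict ∅ D.isLevel_empty
  rw [kuriharaNumber_eq_ratModP_of_eq_one P.f 3 _ _ Finset.prod_empty ψ] at hval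
  -- the level-one certificate and `#Sel^(3) = 1` (NO [S24]: Mazur–Rubin Thm. 4.3.4 at `m = 1`)
  have hcert := apply_empty_not_mem_selmerGroup_kummer_of_dictionary W v₃ κ₀ κ' hI4 Λ hΛker hval rfl hunit
  have hsel : Nat.card (W.selmerGroup (3 : ℤ)) = 1 :=
    natCard_selmerGroup_three_eq_one_of_levelOne_certificate_noS24 W h3 τ hτμ hτq inv hperf hsum hcompl
      hEP S hS h3S hbadS D η hP hT hD κ' hcert
  -- the GZK-free consumer
  exact bsdp_of_card_selmerGroup_eq_one_of_analyticRank_eq_zero W 3 hr hq hv (by exact_mod_cast hsel)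

/-- **The same with `S`, `τ`, `η`, the datum `D` and the place `v₃` discharged existentially — the
EXOTIC unit case from `hPT` + `hEP` + ROW CONDITIONS + THE PORT alone, NO [S24].**  n1011-p13's
`exists_kolyvaginDatum_bsdp_three_of_dictionaryOne_of_facts` with `hS24`, `hS24₂` DELETED: on an
additive `3 ∤ c₃`, surj(3), `E(ℚ₃)[3] = 0`, `r_an = 0`, `3 ∤ #Ш_an` row of a globally minimal `W/ℚ`
with a modular parametrisation `P`, `3 ∤ c_P`, the unit period transfer and a `3`-adic unit `[0]⁺`,
granted the named facts `hPT` (Poitou–Tate for Selmer structures) and `hEP` (Tate), THERE ARE an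
admissible `S` (x11b `KummerPT.exists_exceptional_finset`), `τ` (from surj(3)), `η`, `D` (n1011-p04
T-HCC) and `v₃ ∣ 3` such that the level-one dictionary `KatoKuriharaDictionaryThreeOneAt W 0 D v₃`
ALONE implies `BSD(E, 3)`.  Binders of record: TWO named facts (was four), six row conditions, the
modular-parametrisation data, the instance `[Finite E[3]]`, THE PORT.  Nothing booked; EXOTIC rows
REDUCED, none closed; no mark / label changed. [cite: Kim2022StructureSelmer, Thm. 3.13]
[cite: Rubin2011, Thm. 2.8.4 (p. 25)] [cite: MilneADT2006, Ch. I, Thm. 4.10(b)] -/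
theorem exists_kolyvaginDatum_bsdp_three_of_dictionaryOne_of_facts_noS24 [W.IsGloballyMinimal]
    (hPT : poitouTate_selmerStructure_duality ℚ)
    (hEP : ∀ v : HeightOneSpectrum (𝓞 ℚ), localEulerPoincareCharacteristic (v.adicCompletion ℚ))
    [Finite (geomTorsion W ((3 : ℕ) : ℤ))]
    (hX : Addv W 3) (hc3 : ¬ 3 ∣ (W.baseChange ℚ_[3]).localTamagawaNumber ℤ_[3])
    (h3 : W.HasSurjectiveModNGaloisRep ((3 : ℕ) : ℤ)) (hr : W.analyticRank = 0)
    (ht : Nat.card {Q : (W.baseChange ℚ_[3]).toAffine.Point // (3 : ℕ) • Q = 0} = 1)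
    {q : ℚ} (hq : shaAn W = (q : ℂ)) (hv : padicValRat 3 q = 0)
    {N : ℕ} [NeZero N] (P : ModularParametrizationData W N)
    (hManin : ¬ ((3 : ℕ) : ℤ) ∣ P.maninConstant)
    (hΩ : ∃ u : ℚ, ‖(u : ℚ_[3])‖ = 1 ∧ W.realPeriodRat = u * plusPeriod P.f)
    (hunit : ratModP 3 (ratPlusSymbol P.f 0) ≠ 0) :
    ∃ (S : Finset (Place ℚ)) (τ : absoluteGaloisGroup ℚ)
      (η : (q : HeightOneSpectrum (𝓞 ℚ)) → (ZMod (Ideal.absNorm q.asIdeal))ˣ)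
      (D : KolyvaginDatum (W.torsionGaloisModule ((3 : ℕ) : ℤ))) (v₃ : HeightOneSpectrum (𝓞 ℚ)),
      (∀ w : InfinitePlace ℚ, (Sum.inl w : Place ℚ) ∈ S) ∧
      (∀ v : HeightOneSpectrum (𝓞 ℚ), ((3 : ℕ) : 𝓞 ℚ) ∈ v.asIdeal → (Sum.inr v : Place ℚ) ∈ S) ∧
      (∀ v : HeightOneSpectrum (𝓞 ℚ), ¬ W.HasGoodReductionAt v → (Sum.inr v : Place ℚ) ∈ S) ∧
      τ ∈ rootsOfUnityFixer ℚ 3 ∧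
      Nonempty (cokerSubOne (W.torsionGaloisModule ((3 : ℕ) : ℤ)) τ ≃+ ZMod 3) ∧
      D.primes = frobeniusClassPrimes (W.torsionGaloisModule ((3 : ℕ) : ℤ))
        {v | (Sum.inr v : Place ℚ) ∈ S} τ 3 ∧
      D.transverse = cyclotomicTransverse (W.torsionGaloisModule ((3 : ℕ) : ℤ)) ∧
      D.HasCanonicalComparison 3 η ∧ ((3 : ℕ) : 𝓞 ℚ) ∈ v₃.asIdeal ∧
      (KatoKuriharaDictionaryThreeOneAt W 0 D v₃ → BSDp W 3) := by
  haveI : Fact (Nat.Prime 3) := ⟨Nat.prime_three⟩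
  obtain ⟨S, -, hS, h3S, hbadS⟩ := X11b.KummerPT.exists_exceptional_finset W 3 (∅ : Finset (Place ℚ))
  obtain ⟨τ, hτ, hτq⟩ := exists_rootsOfUnityFixer_cokerSubOne_equiv_zmod_three_of_surj W h3
  have hτμ : τ ∈ rootsOfUnityFixer ℚ 3 := hτ 3 (by norm_num)
  obtain ⟨η, D, hP, hT, hD⟩ :=
    FSComp.exists_eta_kolyvaginDatum_hasCanonicalComparison_frobeniusClassPrimes
      (W.torsionGaloisModule ((3 : ℕ) : ℤ)) 3 {v | (Sum.inr v : Place ℚ) ∈ S} hτμ hτq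
      (cyclotomicTransverse (W.torsionGaloisModule ((3 : ℕ) : ℤ)))
  let v₃ : HeightOneSpectrum (𝓞 ℚ) := (Rat.HeightOneSpectrum.primesEquiv (R := 𝓞 ℚ)).symm ⟨3, Nat.prime_three⟩
  have hv₃ : ((3 : ℕ) : 𝓞 ℚ) ∈ v₃.asIdeal := three_mem_primesEquiv_symm_three
  exact ⟨S, τ, η, D, v₃, hS, h3S, hbadS, hτμ, hτq, hP, hT, hD, hv₃, fun hDict =>
    bsdp_three_of_dictionaryOne_of_facts_noS24 W hPT hEP hX hc3 h3 hr ht hq hv τ hτμ hτq S hS h3S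
      hbadS D η hP hT hD v₃ hv₃ hDict P hManin hΩ hunit⟩

/-- **The EXOTIC unit case from n1011-p09's port at depth `k = 0`, `hPT` + `hEP` only, NO GZK, NO
[S24]** — the `∃`-form `exists_kolyvaginDatum_bsdp_three_of_dictionaryOne_of_facts_noS24` read
through p13's `katoKuriharaDictionaryThreeAt_zero_iff_threeOneAt` (ONE PORT, TWO SPELLINGS — a kernel
`Iff.rfl`): granted `hPT`, `hEP` and the row conditions, there are `S, τ, η, D, v₃` such that
`KatoKuriharaDictionaryThreeAt W 0 0 D v₃ → BSD(E, 3)`.  n1011-p13's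
`exists_kolyvaginDatum_bsdp_three_of_dictionaryAt_zero_of_facts` with `hS24`, `hS24₂` DELETED.
Nothing booked; EXOTIC rows REDUCED, none closed. [cite: Kim2022StructureSelmer, Thm. 3.13]
[cite: Rubin2011, Thm. 2.8.4 (p. 25)] -/
theorem exists_kolyvaginDatum_bsdp_three_of_dictionaryAt_zero_of_facts_noS24 [W.IsGloballyMinimal]
    (hPT : poitouTate_selmerStructure_duality ℚ)
    (hEP : ∀ v : HeightOneSpectrum (𝓞 ℚ), localEulerPoincareCharacteristic (v.adicCompletion ℚ))
    [Finite (geomTorsion W ((3 : ℕ) : ℤ))]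
    (hX : Addv W 3) (hc3 : ¬ 3 ∣ (W.baseChange ℚ_[3]).localTamagawaNumber ℤ_[3])
    (h3 : W.HasSurjectiveModNGaloisRep ((3 : ℕ) : ℤ)) (hr : W.analyticRank = 0)
    (ht : Nat.card {Q : (W.baseChange ℚ_[3]).toAffine.Point // (3 : ℕ) • Q = 0} = 1)
    {q : ℚ} (hq : shaAn W = (q : ℂ)) (hv : padicValRat 3 q = 0)
    {N : ℕ} [NeZero N] (P : ModularParametrizationData W N)
    (hManin : ¬ ((3 : ℕ) : ℤ) ∣ P.maninConstant)
    (hΩ : ∃ u : ℚ, ‖(u : ℚ_[3])‖ = 1 ∧ W.realPeriodRat = u * plusPeriod P.f)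
    (hunit : ratModP 3 (ratPlusSymbol P.f 0) ≠ 0) :
    ∃ (S : Finset (Place ℚ)) (τ : absoluteGaloisGroup ℚ)
      (η : (q : HeightOneSpectrum (𝓞 ℚ)) → (ZMod (Ideal.absNorm q.asIdeal))ˣ)
      (D : KolyvaginDatum (W.torsionGaloisModule ((3 : ℕ) : ℤ))) (v₃ : HeightOneSpectrum (𝓞 ℚ)),
      (∀ w : InfinitePlace ℚ, (Sum.inl w : Place ℚ) ∈ S) ∧
      (∀ v : HeightOneSpectrum (𝓞 ℚ), ((3 : ℕ) : 𝓞 ℚ) ∈ v.asIdeal → (Sum.inr v : Place ℚ) ∈ S) ∧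
      (∀ v : HeightOneSpectrum (𝓞 ℚ), ¬ W.HasGoodReductionAt v → (Sum.inr v : Place ℚ) ∈ S) ∧
      τ ∈ rootsOfUnityFixer ℚ 3 ∧
      Nonempty (cokerSubOne (W.torsionGaloisModule ((3 : ℕ) : ℤ)) τ ≃+ ZMod 3) ∧
      D.primes = frobeniusClassPrimes (W.torsionGaloisModule ((3 : ℕ) : ℤ))
        {v | (Sum.inr v : Place ℚ) ∈ S} τ 3 ∧
      D.transverse = cyclotomicTransverse (W.torsionGaloisModule ((3 : ℕ) : ℤ)) ∧
      D.HasCanonicalComparison 3 η ∧ ((3 : ℕ) : 𝓞 ℚ) ∈ v₃.asIdeal ∧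
      (KatoKuriharaDictionaryThreeAt W 0 0 D v₃ → BSDp W 3) :=
  exists_kolyvaginDatum_bsdp_three_of_dictionaryOne_of_facts_noS24 W hPT hEP hX hc3 h3 hr ht hq hv P
    hManin hΩ hunit

end Summit.BirchSwinnertonDyer.Rank1Residual.GaloisImage

end
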